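import Summits.AtomisticToContinuum.Crystallization.Theses.FluxTubeKepler
import Summits.AtomisticToContinuum.Crystallization.Theorems.FluxTubeKeplerFluxCellKeplerEnergyIdentity

/-!
# `KeplerEnergyFloor` (stmt-AtomisticToContinuum-15222), route FluxTubeKepler — PROVED

The crux `FluxTubeKepler.KeplerEnergyFloor` is routine bookkeeping over the route's main crux
`FluxCellKepler = ∃ P₀ R₁ τ, DOM ∧ KEPLER`:

* energy identity (landed: `FluxCellKeplerSketch.interactionEnergy_lennardJones_eq_sum`)
  `E_LJ(x) = Σ_i ((1/24) site₁₂(x)_i − (1/12) site₆(x)_i)`;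
* DOM `Σ_i site₆(x)_i ≤ Σ_i τ_i` enters with the sign `−1/12`, so the cell sum
  `Σ_i ((1/24) site₁₂ − (1/12) τ_i)` is at most `E_LJ(x)`;
* KEPLER at the Lennard-Jones minimal distance `δ` (hypothesis `LennardJonesMinimalDistance`,
  proved in the tree) gives `N·e(P₀) + c·#bad ≤ cell sum ≤ E_LJ(x)` along ground states
  (ground states are injective by definition of `IsGroundState`);
* the first conjunct drops `c·#bad ≥ 0` (at `R = η = 1`).

Line `Sketch` of the crux chain (candidate proof `Cruxes/KeplerEnergyFloor/Attack.lean` by the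
crux-attack refuter, re-verified by the ideation seats); landed here against the route decl by name.
-/

namespace Summit.AtomisticToContinuum.Crystallization.Theorems

open scoped BigOperators
open Literature.MathematicalPhysics.StatisticalMechanics

/-- Abstract chaining of DOM into KEPLER: a sum bound `Σ S₆ ≤ Σ T` and a lower bound for the
`T`-cell sum `c·K ≤ Σ ((1/24) S₁₂ − (1/12) T) − E` give the `T`-free bound
`E + c·K ≤ Σ ((1/24) S₁₂ − (1/12) S₆)`. [folklore] -/
theorem keplerEnergyFloor_floor_of_dom_kepler {ι : Type*} [Fintype ι] (S₁₂ S₆ T : ι → ℝ)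
    (K E c : ℝ) (hDOM : ∑ i, S₆ i ≤ ∑ i, T i)
    (hKEP : c * K ≤ ∑ i, ((1 / 24 : ℝ) * S₁₂ i - (1 / 12 : ℝ) * T i) - E) :
    E + c * K ≤ ∑ i, ((1 / 24 : ℝ) * S₁₂ i - (1 / 12 : ℝ) * S₆ i) := by
  have h3 : ∑ i, ((1 / 24 : ℝ) * S₁₂ i - (1 / 12 : ℝ) * T i) ≤
      ∑ i, ((1 / 24 : ℝ) * S₁₂ i - (1 / 12 : ℝ) * S₆ i) := by
    simp only [Finset.sum_sub_distrib, ← Finset.mul_sum]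
    linarith
  linarith

/-- The floor alone: under the hypotheses of `keplerEnergyFloor_floor_of_dom_kepler` with `0 < c`
and `0 ≤ K`, the penalty `c·K ≥ 0` may be dropped: `E ≤ Σ ((1/24) S₁₂ − (1/12) S₆)`. [folklore] -/
theorem keplerEnergyFloor_floor_of_dom_kepler' {ι : Type*} [Fintype ι] (S₁₂ S₆ T : ι → ℝ)
    (K E c : ℝ) (hDOM : ∑ i, S₆ i ≤ ∑ i, T i)
    (hKEP : c * K ≤ ∑ i, ((1 / 24 : ℝ) * S₁₂ i - (1 / 12 : ℝ) * T i) - E)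
    (hc : 0 < c) (hK : 0 ≤ K) :
    E ≤ ∑ i, ((1 / 24 : ℝ) * S₁₂ i - (1 / 12 : ℝ) * S₆ i) := by
  have h1 := keplerEnergyFloor_floor_of_dom_kepler S₁₂ S₆ T K E c hDOM hKEP
  have h2 : 0 ≤ c * K := mul_nonneg hc.le hK
  linarith

/-- **`KeplerEnergyFloor` holds** (item stmt-AtomisticToContinuum-15222): from `FluxCellKepler`
and `LennardJonesMinimalDistance`, the witness `P₀` of `FluxCellKepler` satisfies the floor
`N·e(P₀) ≤ E_LJ(x)` and, for all `R, η > 0`, the defect budget `c·#bad_{R,η}(x) ≤ E_LJ(x) − N·e(P₀)`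
along Lennard-Jones ground states `x`. Proof: energy identity, DOM with sign `−1/12`, KEPLER at the
minimal distance `δ`. [folklore] -/
theorem keplerEnergyFloor_proof :
    Summit.AtomisticToContinuum.Crystallization.Theses.FluxTubeKepler.KeplerEnergyFloor := by
  unfold Summit.AtomisticToContinuum.Crystallization.Theses.FluxTubeKepler.KeplerEnergyFloor
  intro hK hmd
  obtain ⟨P₀, R₁, τ, hDOM, hKEP⟩ := hK
  obtain ⟨δ, hδ, hsep⟩ := hmd
  refine ⟨P₀, ?_, ?_⟩
  · intro N x hx
    obtain ⟨c, hc, h⟩ := hKEP δ hδ 1 1 one_pos one_pos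
    have h1 := keplerEnergyFloor_floor_of_dom_kepler' _ _ _ _ _ _ (hDOM N x hx.1)
      (h N x hx.1 (hsep N x hx)) hc (by positivity)
    rw [← FluxCellKeplerSketch.interactionEnergy_lennardJones_eq_sum] at h1
    exact h1
  · intro R η hR hη
    obtain ⟨c, hc, h⟩ := hKEP δ hδ R η hR hη
    refine ⟨c, hc, fun N x hx => ?_⟩
    have h1 := keplerEnergyFloor_floor_of_dom_kepler _ _ _ _ _ _ (hDOM N x hx.1)
      (h N x hx.1 (hsep N x hx))
    rw [← FluxCellKeplerSketch.interactionEnergy_lennardJones_eq_sum] at h1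
    linarith

end Summit.AtomisticToContinuum.Crystallization.Theorems
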